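import Summits.Ventures.PercRepro.S1DisjointSumRank

/-!
# PercRepro — DISJOINT SUMS OF CORES: `e`-FREE, COLOOP-FREE, AND THE CIRCUITS ADD (p2, gen 27; SUBCLAIM-S1
§6.10 (xvi)(d), (xvii))

The abstract half of the witness argument of §6.10 (xvi)(d): a disjoint sum of `e`-free matroids is `e`-free (for
`e ∈ M.E` take the partition `A_M ∪ N.E` / the rest, closures being trace-wise by S1DisjointSumRank), a disjoint sum
of coloop-free matroids is coloop-free (a coloop lies in every base; the bases of the sum are unions of bases), and
the circuits of a disjoint sum are exactly the circuits of the parts — so `s₃`, `s₄`, … add. Nothing is claimed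
about any cell.

* **`disjointSum_free`**, **`disjointSum_coloops_eq_empty`**;
* **`disjointSum_isCircuit_iff`**, **`disjointSum_ncard_circuits_eq`**.
Axioms: standard.
-/

open scoped Matroid

namespace PercRepro

namespace S1

open Set

variable {α : Type}

/-- **A disjoint sum of `e`-free matroids is `e`-free**: for `e ∈ M.E` take `A_M ∪ N.E`. -/
theorem disjointSum_free (M N : Matroid α) [M.Finite] [N.Finite] (h : Disjoint M.E N.E)
    (hM : ∀ e ∈ M.E, ∃ A ⊆ M.E \ {e}, e ∉ M.closure A ∧ e ∉ M.closure ((M.E \ {e}) \ A))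
    (hN : ∀ e ∈ N.E, ∃ A ⊆ N.E \ {e}, e ∉ N.closure A ∧ e ∉ N.closure ((N.E \ {e}) \ A)) :
    ∀ e ∈ (M.disjointSum N h).E, ∃ A ⊆ (M.disjointSum N h).E \ {e},
      e ∉ (M.disjointSum N h).closure A ∧ e ∉ (M.disjointSum N h).closure (((M.disjointSum N h).E \ {e}) \ A) := by
  intro e he
  rw [Matroid.disjointSum_ground_eq] at he ⊢
  rcases he with he | he
  · obtain ⟨A, hA, h1, h2⟩ := hM e he
    have heN : e ∉ N.E := h.notMem_of_mem_left he
    have hAM : A ⊆ M.E := hA.trans sdiff_subset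
    have heA : e ∉ A := fun hx => (hA hx).2 rfl
    refine ⟨A ∪ N.E, ?_, ?_, ?_⟩
    · intro x hx
      rcases hx with hx | hx
      · exact ⟨Or.inl (hAM hx), fun hxe => heA (hxe ▸ hx)⟩
      · exact ⟨Or.inr hx, fun hxe => heN (hxe ▸ hx)⟩
    · rw [disjointSum_mem_closure_iff_left M N h he (union_subset (hAM.trans subset_union_left) subset_union_right)]
      have : (A ∪ N.E) ∩ M.E = A := by
        ext x; constructor
        · rintro ⟨hx | hx, hxM⟩
          · exact hx
          · exact absurd hxM (h.symm.notMem_of_mem_left hx)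
        · intro hx; exact ⟨Or.inl hx, hAM hx⟩
      rw [this]; exact h1
    · rw [disjointSum_mem_closure_iff_left M N h he (sdiff_subset.trans sdiff_subset)]
      have : (((M.E ∪ N.E) \ {e}) \ (A ∪ N.E)) ∩ M.E = (M.E \ {e}) \ A := by
        ext x
        have hx : x ∈ M.E → x ∉ N.E := fun hxM => h.notMem_of_mem_left hxM
        simp only [mem_inter_iff, mem_sdiff, mem_union, mem_singleton_iff, not_or]
        tauto
      rw [this]; exact h2
  · obtain ⟨A, hA, h1, h2⟩ := hN e he
    have heM : e ∉ M.E := h.symm.notMem_of_mem_left he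
    have hAN : A ⊆ N.E := hA.trans sdiff_subset
    have heA : e ∉ A := fun hx => (hA hx).2 rfl
    refine ⟨A ∪ M.E, ?_, ?_, ?_⟩
    · intro x hx
      rcases hx with hx | hx
      · exact ⟨Or.inr (hAN hx), fun hxe => heA (hxe ▸ hx)⟩
      · exact ⟨Or.inl hx, fun hxe => heM (hxe ▸ hx)⟩
    · rw [disjointSum_mem_closure_iff_right M N h he (union_subset (hAN.trans subset_union_right) subset_union_left)]
      have : (A ∪ M.E) ∩ N.E = A := by
        ext x; constructor
        · rintro ⟨hx | hx, hxN⟩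
          · exact hx
          · exact absurd hxN (h.notMem_of_mem_left hx)
        · intro hx; exact ⟨Or.inl hx, hAN hx⟩
      rw [this]; exact h1
    · rw [disjointSum_mem_closure_iff_right M N h he (sdiff_subset.trans sdiff_subset)]
      have : (((M.E ∪ N.E) \ {e}) \ (A ∪ M.E)) ∩ N.E = (N.E \ {e}) \ A := by
        ext x
        have hx : x ∈ N.E → x ∉ M.E := fun hxN => h.symm.notMem_of_mem_left hxN
        simp only [mem_inter_iff, mem_sdiff, mem_union, mem_singleton_iff, not_or]
        tauto
      rw [this]; exact h2

/-- **A disjoint sum of coloop-free matroids is coloop-free**: a coloop lies in every base, and the bases of the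
sum are the unions of bases of the parts. -/
theorem disjointSum_coloops_eq_empty (M N : Matroid α) (h : Disjoint M.E N.E)
    (hM : M.coloops = ∅) (hN : N.coloops = ∅) : (M.disjointSum N h).coloops = ∅ := by
  rw [Set.eq_empty_iff_forall_notMem]
  intro e he
  rw [← Matroid.isColoop_iff_mem_coloops, Matroid.isColoop_iff_forall_mem_isBase] at he
  have heE : e ∈ (M.disjointSum N h).E := by
    obtain ⟨B, hB⟩ := (M.disjointSum N h).exists_isBase
    exact hB.subset_ground (he hB)
  rw [Matroid.disjointSum_ground_eq] at heE
  rcases heE with heM | heN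
  · -- `e` would be a coloop of `M`
    have : M.IsColoop e := by
      rw [Matroid.isColoop_iff_forall_mem_isBase]
      intro BM hBM
      obtain ⟨BN, hBN⟩ := N.exists_isBase
      have hB : (M.disjointSum N h).IsBase (BM ∪ BN) := by
        rw [Matroid.disjointSum_isBase_iff]
        have h1 : (BM ∪ BN) ∩ M.E = BM := by
          ext x; constructor
          · rintro ⟨hx | hx, hxM⟩
            · exact hx
            · exact absurd hxM (h.symm.notMem_of_mem_left (hBN.subset_ground hx))
          · intro hx; exact ⟨Or.inl hx, hBM.subset_ground hx⟩
        have h2 : (BM ∪ BN) ∩ N.E = BN := by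
          ext x; constructor
          · rintro ⟨hx | hx, hxN⟩
            · exact absurd hxN (h.notMem_of_mem_left (hBM.subset_ground hx))
            · exact hx
          · intro hx; exact ⟨Or.inr hx, hBN.subset_ground hx⟩
        rw [h1, h2]
        exact ⟨hBM, hBN, union_subset (hBM.subset_ground.trans subset_union_left)
          (hBN.subset_ground.trans subset_union_right)⟩
      rcases he hB with hx | hx
      · exact hx
      · exact absurd (hBN.subset_ground hx) (h.notMem_of_mem_left heM)
    rw [Matroid.isColoop_iff_mem_coloops, hM] at this
    exact this
  · have : N.IsColoop e := by
      rw [Matroid.isColoop_iff_forall_mem_isBase]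
      intro BN hBN
      obtain ⟨BM, hBM⟩ := M.exists_isBase
      have hB : (M.disjointSum N h).IsBase (BM ∪ BN) := by
        rw [Matroid.disjointSum_isBase_iff]
        have h1 : (BM ∪ BN) ∩ M.E = BM := by
          ext x; constructor
          · rintro ⟨hx | hx, hxM⟩
            · exact hx
            · exact absurd hxM (h.symm.notMem_of_mem_left (hBN.subset_ground hx))
          · intro hx; exact ⟨Or.inl hx, hBM.subset_ground hx⟩
        have h2 : (BM ∪ BN) ∩ N.E = BN := by
          ext x; constructor
          · rintro ⟨hx | hx, hxN⟩
            · exact absurd hxN (h.notMem_of_mem_left (hBM.subset_ground hx))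
            · exact hx
          · intro hx; exact ⟨Or.inr hx, hBN.subset_ground hx⟩
        rw [h1, h2]
        exact ⟨hBM, hBN, union_subset (hBM.subset_ground.trans subset_union_left)
          (hBN.subset_ground.trans subset_union_right)⟩
      rcases he hB with hx | hx
      · exact absurd (hBM.subset_ground hx) (h.symm.notMem_of_mem_left heN)
      · exact hx
    rw [Matroid.isColoop_iff_mem_coloops, hN] at this
    exact this

/-- **The circuits of a disjoint sum are the circuits of the parts.** -/
theorem disjointSum_isCircuit_iff (M N : Matroid α) (h : Disjoint M.E N.E) (C : Set α) :
    (M.disjointSum N h).IsCircuit C ↔ M.IsCircuit C ∨ N.IsCircuit C := by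
  have hdep : ∀ D ⊆ M.E ∪ N.E, (M.disjointSum N h).Dep D ↔ ¬ M.Indep (D ∩ M.E) ∨ ¬ N.Indep (D ∩ N.E) := by
    intro D hD
    rw [Matroid.dep_iff, Matroid.disjointSum_indep_iff, Matroid.disjointSum_ground_eq]
    constructor
    · rintro ⟨hni, -⟩
      by_contra hcon
      push Not at hcon
      exact hni ⟨hcon.1, hcon.2, hD⟩
    · intro hor
      refine ⟨fun hi => ?_, hD⟩
      rcases hor with h1 | h1
      · exact h1 hi.1
      · exact h1 hi.2.1
  constructor
  · intro hC
    have hCE : C ⊆ M.E ∪ N.E := by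
      have := hC.subset_ground; rwa [Matroid.disjointSum_ground_eq] at this
    rw [Matroid.isCircuit_iff] at hC
    obtain ⟨hCdep, hmin⟩ := hC
    rcases (hdep C hCE).1 hCdep with hM | hN
    · -- the trace on `M.E` is dependent in the sum, so it is all of `C`
      have hsub : C ∩ M.E = C := by
        apply hmin
        · rw [hdep _ (inter_subset_left.trans hCE)]
          left
          rwa [inter_assoc, inter_self]
        · exact inter_subset_left
      have hCM : C ⊆ M.E := by rw [← hsub]; exact inter_subset_right
      left
      rw [Matroid.isCircuit_iff]
      refine ⟨⟨by rwa [hsub] at hM, hCM⟩, ?_⟩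
      intro D hD hDC
      apply hmin _ hDC
      rw [hdep D (hDC.trans hCE)]
      left
      rw [inter_eq_self_of_subset_left hD.subset_ground]
      exact hD.1
    · have hsub : C ∩ N.E = C := by
        apply hmin
        · rw [hdep _ (inter_subset_left.trans hCE)]
          right
          rwa [inter_assoc, inter_self]
        · exact inter_subset_left
      have hCN : C ⊆ N.E := by rw [← hsub]; exact inter_subset_right
      right
      rw [Matroid.isCircuit_iff]
      refine ⟨⟨by rwa [hsub] at hN, hCN⟩, ?_⟩
      intro D hD hDC
      apply hmin _ hDC
      rw [hdep D (hDC.trans hCE)]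
      right
      rw [inter_eq_self_of_subset_left hD.subset_ground]
      exact hD.1
  · rintro (hC | hC)
    · have hCM : C ⊆ M.E := hC.subset_ground
      rw [Matroid.isCircuit_iff] at hC ⊢
      obtain ⟨hCdep, hmin⟩ := hC
      refine ⟨?_, ?_⟩
      · rw [hdep C (hCM.trans subset_union_left)]
        left
        rw [inter_eq_self_of_subset_left hCM]
        exact hCdep.1
      · intro D hD hDC
        have hDM : D ⊆ M.E := hDC.trans hCM
        have hDE : D ⊆ M.E ∪ N.E := hDM.trans subset_union_left
        rw [hdep D hDE] at hD
        rcases hD with hD | hD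
        · rw [inter_eq_self_of_subset_left hDM] at hD
          exact hmin ⟨hD, hDM⟩ hDC
        · exfalso
          apply hD
          have : D ∩ N.E = ∅ := by
            rw [Set.eq_empty_iff_forall_notMem]
            rintro x ⟨hxD, hxN⟩
            exact h.notMem_of_mem_left (hDM hxD) hxN
          rw [this]; exact N.empty_indep
    · have hCN : C ⊆ N.E := hC.subset_ground
      rw [Matroid.isCircuit_iff] at hC ⊢
      obtain ⟨hCdep, hmin⟩ := hC
      refine ⟨?_, ?_⟩
      · rw [hdep C (hCN.trans subset_union_right)]
        right
        rw [inter_eq_self_of_subset_left hCN]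
        exact hCdep.1
      · intro D hD hDC
        have hDN : D ⊆ N.E := hDC.trans hCN
        have hDE : D ⊆ M.E ∪ N.E := hDN.trans subset_union_right
        rw [hdep D hDE] at hD
        rcases hD with hD | hD
        · exfalso
          apply hD
          have : D ∩ M.E = ∅ := by
            rw [Set.eq_empty_iff_forall_notMem]
            rintro x ⟨hxD, hxM⟩
            exact h.symm.notMem_of_mem_left (hDN hxD) hxM
          rw [this]; exact M.empty_indep
        · rw [inter_eq_self_of_subset_left hDN] at hD
          exact hmin ⟨hD, hDN⟩ hDC

/-- **The `k`-circuits of a disjoint sum are counted by the parts**: `s_k (M ⊕ N) = s_k M + s_k N`. -/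
theorem disjointSum_ncard_circuits_eq (M N : Matroid α) [M.Finite] [N.Finite] (h : Disjoint M.E N.E) (k : ℕ) :
    {C : Set α | (M.disjointSum N h).IsCircuit C ∧ C.ncard = k}.ncard =
      {C : Set α | M.IsCircuit C ∧ C.ncard = k}.ncard + {C : Set α | N.IsCircuit C ∧ C.ncard = k}.ncard := by
  have hset : {C : Set α | (M.disjointSum N h).IsCircuit C ∧ C.ncard = k} =
      {C : Set α | M.IsCircuit C ∧ C.ncard = k} ∪ {C : Set α | N.IsCircuit C ∧ C.ncard = k} := by
    ext C
    simp only [mem_setOf_eq, mem_union, disjointSum_isCircuit_iff]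
    tauto
  have hfinM : {C : Set α | M.IsCircuit C ∧ C.ncard = k}.Finite :=
    M.ground_finite.finite_subsets.subset (fun _ hC => hC.1.subset_ground)
  have hfinN : {C : Set α | N.IsCircuit C ∧ C.ncard = k}.Finite :=
    N.ground_finite.finite_subsets.subset (fun _ hC => hC.1.subset_ground)
  have hdisj : Disjoint {C : Set α | M.IsCircuit C ∧ C.ncard = k} {C : Set α | N.IsCircuit C ∧ C.ncard = k} := by
    rw [Set.disjoint_left]
    rintro C ⟨hCM, -⟩ ⟨hCN, -⟩
    obtain ⟨x, hx⟩ := hCM.nonempty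
    exact h.notMem_of_mem_left (hCM.subset_ground hx) (hCN.subset_ground hx)
  rw [hset, Set.ncard_union_eq hdisj hfinM hfinN]

end S1

end PercRepro
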